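import Summits.ResolutionOfSingularities.ResolutionOfSingularities.Theorems.RadicialJungCleanModelsGiraudChartShrink
import Summits.ResolutionOfSingularities.ResolutionOfSingularities.Theorems.RadicialJungCleanModelsGiraudAwayDualDerivations
import Summits.ResolutionOfSingularities.ResolutionOfSingularities.Theorems.RadicialJungCleanModelsGiraudCriticalPrimesLocalization
import Summits.ResolutionOfSingularities.ResolutionOfSingularities.Theorems.RadicialJungCleanModelsKaehlerProjective
import Literature.AlgebraicGeometry.Resolution.StrictNormalCrossings
import Literature.AlgebraicGeometry.Resolution.SpreadingGerms
import HarnessLib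

/-!
# Route `RadicialJung`, crux `CleanModels` (stmt-15917): GIRAUD CHARTS AT CLOSED POINTS — brick B3,
# piece (S1e, scheme level) of `HOME/L/res-L0-w81-pv-2/g5/S1-SPEC.md`

Support file (OURS) for PROGRAMME-clean-dim2 / T2 (`T2-ARCHITECTURE.md`, brick **B3**): the chart
construction feeding `finite_setOf_isGiraudSingularPoint_of_charts` (FILE 5, res-L1-s42-pv-2).

Let `X` be a regular integral scheme locally of finite type over a field `k` of characteristic
`p`, `f ∈ Γ(X, 𝒪_X)`, and suppose the critical set `E(f)` (`derivCriticalSet`) is a strict normal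
crossings divisor.  For every closed point `ξ₀ ∈ X` we produce an affine open `V ∋ ξ₀`, sections
`x_1, …, x_r ∈ Γ(X, V)` and derivations `δ_1, …, δ_r ∈ Der_ℤ Γ(X, V)` with `δ_a(x_b) = [a = b]`,
such that for every `ξ ∈ V` the critical primes of `f` in `𝒪_{X,ξ}` (height-one primes containing
the Jacobian ideal `J(𝒪_{X,ξ}, f)`) are exactly the `(x_j)𝒪_{X,ξ}` with `x_j(ξ) = 0`
(`exists_giraudChart_at`).

* Off `E(f)` (`exists_giraudChart_of_not_mem`): `V ⊆ X ∖ E(f)` affine, `r = 0`; no critical primes.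
* At `ξ₀ ∈ E(f)` (`exists_giraudChart_of_mem`): the SNC data give a regular system of parameters
  `(x ; y)` of `𝒪_{X,ξ₀}` with `I(E)_{ξ₀} = (x_1 ⋯ x_r)`; spread it to sections over an affine
  `U₀ ∋ ξ₀`; shrink to `U₁ = D(e₁)` carrying dual derivations (S1d,
  `exists_basicOpen_dual_derivations`); each `(x_i)𝒪_{X,ξ₀}` is a height-one prime, so the pure
  commutative algebra of `exists_away_chart` (S1c) shrinks further to `V = D(e₂)` on which the
  height-one primes containing `I(E)(V)` are exactly the `(x_i)`; `I(E)(V) ≤ 𝔭 ↔ J(Γ(V), f) ≤ 𝔭`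
  (`derivJacobianIdeal_le_prime_iff_vanishingIdeal_le`, using `Ω` projective = S1a); and the stalk
  statement is FILE 6 (`derivCriticalPrimes_iff_of_isLocalization_atPrime`).

References: J. Giraud, *Forme normale d'une fonction sur une surface de caractéristique positive*,
Bull. SMF 111 (1983), Déf. 1.2, 1.6, Lemme 2.6. [cite: Giraud1983]
-/

open CategoryTheory AlgebraicGeometry TopologicalSpace IsLocalRing Opposite
open Literature.AlgebraicGeometry.Resolution
open AlgebraicGeometry.Scheme.IdealSheafData

namespace Summit.ResolutionOfSingularities.ResolutionOfSingularities.Theorems.RadicialJung.CleanModels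

/-- Off the critical set there are no critical primes: if `J(𝒪_{X,ξ}, f) ⊄ 𝔪_ξ` then no proper
prime contains it. [cite: Giraud1983, Déf. 1.2] -/
theorem not_mem_derivCriticalPrimes_of_not_mem_derivCriticalSet {X : Scheme.{0}} (f : Γ(X, ⊤))
    {ξ : X} (hξ : ξ ∉ derivCriticalSet X f) (P : Ideal (X.presheaf.stalk ξ)) :
    P ∉ derivCriticalPrimes (X.presheaf.stalk ξ) (X.presheaf.germ ⊤ ξ trivial f) := by
  rintro ⟨hP, -, hJ⟩
  exact hξ (hJ.trans (IsLocalRing.le_maximalIdeal hP.ne_top))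

/-- **The chart at a point off `E(f)`**: an affine open `V ∋ ξ₀` inside `X ∖ E(f)` (which is open
as `E(f)` is closed), with the empty family of sections; no stalk of `V` has critical primes.
[cite: Giraud1983, Déf. 1.2] -/
theorem exists_giraudChart_of_not_mem {X : Scheme.{0}} (f : Γ(X, ⊤))
    (hE : IsClosed (derivCriticalSet X f)) {ξ₀ : X} (hξ₀ : ξ₀ ∉ derivCriticalSet X f) :
    ∃ (U : X.Opens) (_ : IsAffineOpen U) (_ : ξ₀ ∈ U) (r : ℕ) (x : Fin r → Γ(X, U))
      (δ : Fin r → Derivation ℤ Γ(X, U) Γ(X, U)),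
      (∀ a b, δ a (x b) = if a = b then 1 else 0) ∧
      ∀ (ξ : X) (hξ : ξ ∈ U), ∀ P : Ideal (X.presheaf.stalk ξ),
        P ∈ derivCriticalPrimes (X.presheaf.stalk ξ) (X.presheaf.germ ⊤ ξ trivial f) ↔
          ∃ j, ¬ IsUnit (X.presheaf.germ U ξ hξ (x j)) ∧
            P = Ideal.span {X.presheaf.germ U ξ hξ (x j)} := by
  obtain ⟨U, hU, hξ₀U, hUE⟩ := exists_isAffineOpen_mem_and_subset (X := X) (x := ξ₀)
    (U := ⟨(derivCriticalSet X f)ᶜ, hE.isOpen_compl⟩) hξ₀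
  refine ⟨U, hU, hξ₀U, 0, Fin.elim0, Fin.elim0, fun a => Fin.elim0 a, fun ξ hξ P => ?_⟩
  constructor
  · exact fun h =>
      (not_mem_derivCriticalPrimes_of_not_mem_derivCriticalSet f (hUE hξ) P h).elim
  · rintro ⟨j, -⟩
    exact Fin.elim0 j

/-- In a regular local ring, a member `x_i` of a regular system of parameters `(x ; y)` is
non-zero and `(x_i)` is a prime of height one. [folklore] -/
theorem isPrime_and_height_eq_one_of_rsop {R : Type*} [CommRing R] [IsRegularLocalRing R]
    {r e : ℕ} (x : Fin r → R) (y : Fin e → R) (hdim : ringKrullDim R = (r + e : ℕ))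
    (hspan : Ideal.span (Set.range x ∪ Set.range y) = maximalIdeal R) (i : Fin r) :
    x i ≠ 0 ∧ (Ideal.span {x i}).IsPrime ∧ (Ideal.span {x i}).height = 1 := by
  classical
  haveI : IsDomain R := isDomain_of_isRegularLocalRing R
  have hd := spanFinrank_eq_of_ringKrullDim_eq hdim
  have hz := (span_range_append x y).trans hspan
  have hx0 : x i ≠ 0 := by
    intro h0
    have hni : Fin.castAdd e i ∉ (∅ : Set (Fin (r + e))) := Set.notMem_empty _
    apply not_mem_span_image_of_not_mem hd (Fin.append x y) hz hni
    rw [Fin.append_left, h0]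
    exact zero_mem _
  have hpr := isPrime_span_singleton_of_rsop x y hdim hspan i
  refine ⟨hx0, hpr, le_antisymm ?_ ?_⟩
  · exact Ideal.height_le_one_of_isPrincipal_of_mem_minimalPrimes (Ideal.span {x i}) _
      (by rw [Ideal.minimalPrimes_eq_subsingleton_self]; exact Set.mem_singleton _)
  · rw [Order.one_le_iff_ne_zero, Ne, Ideal.height_eq_zero_iff_eq_bot, Ideal.span_singleton_eq_bot]
    exact hx0

/-- **The chart at a closed point of `E(f)`** (Giraud 1983, proof of 2.4 via Lemme 2.6, chart
form): for `X` regular, integral, locally of finite type over a field of characteristic `p`,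
`E(f)` a strict normal crossings divisor and `ξ₀ ∈ E(f)` a closed point, there is an affine open
`V ∋ ξ₀` with sections `x_1, …, x_r` (local equations of the branches of `E(f)` through `ξ₀`),
dual derivations `δ_a(x_b) = [a = b]` on `Γ(X, V)`, such that at every `ξ ∈ V` the critical
primes of `f` in `𝒪_{X,ξ}` are exactly the `(x_j)` with `x_j` a non-unit at `ξ`.
[cite: Giraud1983, Lemme 2.6] -/
theorem exists_giraudChart_of_mem (p : ℕ) [Fact p.Prime] (k : Type) [Field k] [CharP k p]
    {X : Scheme.{0}} [IsIntegral X] (q : X ⟶ Spec (.of k)) [LocallyOfFiniteType q]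
    (hreg : Scheme.IsRegular X) (f : Γ(X, ⊤))
    (hsnc : IsStrictNormalCrossingsDivisor X (derivCriticalSet X f)) {ξ₀ : X}
    (hξ₀ : IsClosed ({ξ₀} : Set X)) (hξ₀E : ξ₀ ∈ derivCriticalSet X f) :
    ∃ (U : X.Opens) (_ : IsAffineOpen U) (_ : ξ₀ ∈ U) (r : ℕ) (x : Fin r → Γ(X, U))
      (δ : Fin r → Derivation ℤ Γ(X, U) Γ(X, U)),
      (∀ a b, δ a (x b) = if a = b then 1 else 0) ∧
      ∀ (ξ : X) (hξ : ξ ∈ U), ∀ P : Ideal (X.presheaf.stalk ξ),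
        P ∈ derivCriticalPrimes (X.presheaf.stalk ξ) (X.presheaf.germ ⊤ ξ trivial f) ↔
          ∃ j, ¬ IsUnit (X.presheaf.germ U ξ hξ (x j)) ∧
            P = Ideal.span {X.presheaf.germ U ξ hξ (x j)} := by
  classical
  haveI : IsLocallyNoetherian X := LocallyOfFiniteType.isLocallyNoetherian q
  have hE : IsClosed (derivCriticalSet X f) := hsnc.1
  have hCl : (⟨closure (derivCriticalSet X f), isClosed_closure⟩ : Closeds X) =
      ⟨derivCriticalSet X f, hE⟩ := Closeds.ext hE.closure_eq
  -- the strict normal crossings data at `ξ₀`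
  obtain ⟨hRO, r, e, x, y, -, hdimO, hspan, hI⟩ := hsnc.2 ξ₀ hξ₀E
  haveI := hRO
  haveI : IsDomain (X.presheaf.stalk ξ₀) := isDomain_of_isRegularLocalRing _
  have hz := (span_range_append x y).trans hspan
  have hxP := isPrime_and_height_eq_one_of_rsop x y hdimO hspan
  -- spread the regular system of parameters to sections over an affine open `U₀ ∋ ξ₀`
  obtain ⟨U₀, hξU₀, -, a, ha⟩ := exists_affineOpen_sections_of_germs X ξ₀ (Fin.append x y) ⊤ trivial
  haveI : Nonempty (U₀ : X.Opens) := ⟨⟨ξ₀, hξU₀⟩⟩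
  haveI : IsDomain Γ(X, (U₀ : X.Opens)) := IsIntegral.component_integral _
  -- `Γ(X, U₀)` is of finite type over `k`
  let φ : k →+* Γ(X, (U₀ : X.Opens)) :=
    (q.appLE ⊤ U₀ le_top).hom.comp (Scheme.ΓSpecIso (.of k)).inv.hom
  have hφ : φ.FiniteType := by
    refine RingHom.FiniteType.comp ?_ (RingHom.FiniteType.of_surjective _
      (Scheme.ΓSpecIso (.of k)).symm.commRingCatIsoToRingEquiv.surjective)
    exact HasRingHomProperty.appLE @LocallyOfFiniteType q ‹_› ⟨⊤, isAffineOpen_top _⟩ U₀ le_top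
  letI : Algebra k Γ(X, (U₀ : X.Opens)) := φ.toAlgebra
  haveI : Algebra.FiniteType k Γ(X, (U₀ : X.Opens)) := hφ
  -- (S1d) dual derivations on a basic open `U₁ = D(e₁) ∋ ξ₀`
  have ha' : Ideal.span (Set.range fun i => X.presheaf.germ U₀ ξ₀ hξU₀ (a i)) =
      maximalIdeal (X.presheaf.stalk ξ₀) := by
    have : (fun i => X.presheaf.germ U₀ ξ₀ hξU₀ (a i)) = Fin.append x y := funext ha
    rw [this, hz]
  obtain ⟨e₁, hξ₁, δ₁, hδ₁⟩ :=
    exists_basicOpen_dual_derivations U₀.2 k hξU₀ hξ₀ (hreg ξ₀) a ha' hdimO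
  have hU₁ : IsAffineOpen (X.basicOpen e₁) := U₀.2.basicOpen e₁
  -- the chart ring `A = Γ(X, U₁)`, the sections `x₁` and their dual derivations
  let x₁ : Fin r → Γ(X, X.basicOpen e₁) := fun i =>
    algebraMap Γ(X, (U₀ : X.Opens)) Γ(X, X.basicOpen e₁) (a (Fin.castAdd e i))
  have hδ₁' : ∀ j l : Fin r, δ₁ (Fin.castAdd e j) (x₁ l) =
      if j = l then (1 : Γ(X, X.basicOpen e₁)) else 0 := by
    intro j l
    simp only [x₁, hδ₁, (Fin.castAdd_injective _ _).eq_iff]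
  have hgerm₁ : ∀ i, X.presheaf.germ (X.basicOpen e₁) ξ₀ hξ₁ (x₁ i) = x i := by
    intro i
    show X.presheaf.germ (X.basicOpen e₁) ξ₀ hξ₁
      (X.presheaf.map (homOfLE (X.basicOpen_le e₁)).op (a (Fin.castAdd e i))) = x i
    rw [TopCat.Presheaf.germ_res_apply, ha, Fin.append_left]
  -- the stalk at `ξ₀` as the localisation of `A` at `𝔮₀`
  letI := TopCat.Presheaf.algebra_section_stalk X.presheaf (⟨ξ₀, hξ₁⟩ : X.basicOpen e₁)
  haveI := hU₁.isLocalization_stalk ⟨ξ₀, hξ₁⟩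
  haveI : Nonempty (X.basicOpen e₁) := ⟨⟨ξ₀, hξ₁⟩⟩
  haveI : IsDomain Γ(X, X.basicOpen e₁) := IsIntegral.component_integral _
  haveI : IsNoetherianRing Γ(X, X.basicOpen e₁) :=
    IsLocallyNoetherian.component_noetherian ⟨X.basicOpen e₁, hU₁⟩
  have halg : ∀ s, algebraMap Γ(X, X.basicOpen e₁) (X.presheaf.stalk ξ₀) s =
      X.presheaf.germ (X.basicOpen e₁) ξ₀ hξ₁ s := fun _ => rfl
  -- the ideal of `E(f)` on `U₁` and its stalk `(x₁ ⋯ x_r)`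
  have hIS : ((vanishingIdeal ⟨closure (derivCriticalSet X f), isClosed_closure⟩).ideal
      ⟨X.basicOpen e₁, hU₁⟩).map (algebraMap Γ(X, X.basicOpen e₁) (X.presheaf.stalk ξ₀)) =
      Ideal.span {algebraMap Γ(X, X.basicOpen e₁) (X.presheaf.stalk ξ₀) (∏ i, x₁ i)} := by
    have h1 : ((vanishingIdeal ⟨closure (derivCriticalSet X f), isClosed_closure⟩).ideal
        ⟨X.basicOpen e₁, hU₁⟩).map (algebraMap Γ(X, X.basicOpen e₁) (X.presheaf.stalk ξ₀)) =
        ((vanishingIdeal ⟨closure (derivCriticalSet X f), isClosed_closure⟩).ideal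
        ⟨X.basicOpen e₁, hU₁⟩).map (X.presheaf.germ (X.basicOpen e₁) ξ₀ hξ₁).hom := rfl
    rw [h1, hI ⟨X.basicOpen e₁, hU₁⟩ hξ₁, map_prod]
    exact congrArg (fun t => Ideal.span {t})
      (Finset.prod_congr rfl fun i _ => (hgerm₁ i).symm)
  have hxS : ∀ i, (Ideal.span {algebraMap Γ(X, X.basicOpen e₁) (X.presheaf.stalk ξ₀) (x₁ i)}).IsPrime ∧
      (Ideal.span {algebraMap Γ(X, X.basicOpen e₁) (X.presheaf.stalk ξ₀) (x₁ i)}).height = 1 := by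
    intro i
    rw [halg, hgerm₁]
    exact (hxP i).2
  have hI0 : (vanishingIdeal ⟨closure (derivCriticalSet X f), isClosed_closure⟩).ideal
      ⟨X.basicOpen e₁, hU₁⟩ ≠ ⊥ := by
    intro h0
    have h1 : Ideal.span {algebraMap Γ(X, X.basicOpen e₁) (X.presheaf.stalk ξ₀) (∏ i, x₁ i)} = ⊥ := by
      rw [← hIS, h0, Ideal.map_bot]
    rw [Ideal.span_singleton_eq_bot, map_prod, Finset.prod_eq_zero_iff] at h1
    obtain ⟨i, -, hi⟩ := h1
    rw [halg, hgerm₁] at hi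
    exact (hxP i).1 hi
  -- (S1c) shrink to `V = D(e₂)` on which the height-one primes over `I(E)` are the `(x_i)`
  obtain ⟨e₂, he₂, hchart⟩ :=
    exists_away_chart (hU₁.primeIdealOf ⟨ξ₀, hξ₁⟩).asIdeal (X.presheaf.stalk ξ₀) hI0 x₁ hxS hIS
  have hV : IsAffineOpen (X.basicOpen e₂) := hU₁.basicOpen e₂
  haveI := hU₁.isLocalization_basicOpen e₂
  obtain ⟨hxT, honlyT⟩ := hchart Γ(X, X.basicOpen e₂)
  have hξV : ξ₀ ∈ X.basicOpen e₂ :=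
    (X.mem_basicOpen e₂ ξ₀ hξ₁).mpr
      ((IsLocalization.AtPrime.isUnit_to_map_iff (X.presheaf.stalk ξ₀)
        (hU₁.primeIdealOf ⟨ξ₀, hξ₁⟩).asIdeal e₂).mpr he₂)
  let xV : Fin r → Γ(X, X.basicOpen e₂) := fun i =>
    algebraMap Γ(X, X.basicOpen e₁) Γ(X, X.basicOpen e₂) (x₁ i)
  -- dual derivations on `V`
  obtain ⟨δV, hδV⟩ := exists_dual_derivations_of_isLocalization (a := x₁)
    (E := fun j => δ₁ (Fin.castAdd e j)) (e := (1 : Γ(X, X.basicOpen e₁))) hδ₁'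
    Γ(X, X.basicOpen e₂) (Submonoid.powers e₂) (by rw [map_one]; exact isUnit_one)
  -- (S1a) `Ω` is projective on the chart
  haveI := projective_kaehler_sections_of_isAffineOpen p k q hreg hV
  -- the ideal of `E(f)` on `V` is the extension of the one on `U₁`
  have hIV : (vanishingIdeal ⟨derivCriticalSet X f, hE⟩).ideal ⟨X.basicOpen e₂, hV⟩ =
      ((vanishingIdeal ⟨closure (derivCriticalSet X f), isClosed_closure⟩).ideal
        ⟨X.basicOpen e₁, hU₁⟩).map (algebraMap Γ(X, X.basicOpen e₁) Γ(X, X.basicOpen e₂)) := by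
    rw [← hCl]
    exact ((vanishingIdeal _).map_ideal_basicOpen ⟨X.basicOpen e₁, hU₁⟩ e₂).symm
  -- `J(Γ(V), f) ≤ 𝔭 ↔ I(E)(V) ≤ 𝔭`
  have hJI : ∀ 𝔭 : PrimeSpectrum Γ(X, X.basicOpen e₂),
      derivJacobianIdeal Γ(X, X.basicOpen e₂) (X.presheaf.map (homOfLE le_top).op f) ≤ 𝔭.asIdeal ↔
        ((vanishingIdeal ⟨closure (derivCriticalSet X f), isClosed_closure⟩).ideal
          ⟨X.basicOpen e₁, hU₁⟩).map (algebraMap Γ(X, X.basicOpen e₁) Γ(X, X.basicOpen e₂)) ≤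
          𝔭.asIdeal := by
    intro 𝔭
    rw [derivJacobianIdeal_le_prime_iff_vanishingIdeal_le hV f hE 𝔭, hIV]
  have hx6 : ∀ j, (Ideal.span {xV j}).IsPrime ∧ (Ideal.span {xV j}).height = 1 ∧
      derivJacobianIdeal Γ(X, X.basicOpen e₂) (X.presheaf.map (homOfLE le_top).op f) ≤
        Ideal.span {xV j} := by
    intro j
    obtain ⟨hpr, hht, hle⟩ := hxT j
    exact ⟨hpr, hht, (hJI ⟨Ideal.span {xV j}, hpr⟩).mpr hle⟩
  have honly6 : ∀ 𝔭 : Ideal Γ(X, X.basicOpen e₂), 𝔭.IsPrime → 𝔭.height = 1 →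
      derivJacobianIdeal Γ(X, X.basicOpen e₂) (X.presheaf.map (homOfLE le_top).op f) ≤ 𝔭 →
        ∃ j, 𝔭 = Ideal.span {xV j} := by
    intro 𝔭 hpr hht hle
    exact honlyT 𝔭 hpr hht ((hJI ⟨𝔭, hpr⟩).mp hle)
  -- (FILE 6) the critical primes of every stalk of `V`
  refine ⟨X.basicOpen e₂, hV, hξV, r, xV, δV, hδV, fun ξ hξ P => ?_⟩
  letI := TopCat.Presheaf.algebra_section_stalk X.presheaf (⟨ξ, hξ⟩ : X.basicOpen e₂)
  haveI := hV.isLocalization_stalk ⟨ξ, hξ⟩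
  have hgerm : algebraMap Γ(X, X.basicOpen e₂) (X.presheaf.stalk ξ)
      (X.presheaf.map (homOfLE le_top).op f) = X.presheaf.germ ⊤ ξ trivial f :=
    X.presheaf.germ_res_apply (homOfLE le_top) _ hξ f
  have h6 := derivCriticalPrimes_iff_of_isLocalization_atPrime
    (hV.primeIdealOf ⟨ξ, hξ⟩).asIdeal (X.presheaf.stalk ξ)
    (X.presheaf.map (homOfLE le_top).op f) xV hx6 honly6 P
  rw [hgerm] at h6
  exact h6

/-- **Giraud charts exist at every closed point** (both cases). [cite: Giraud1983, Lemme 2.6] -/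
theorem exists_giraudChart_at (p : ℕ) [Fact p.Prime] (k : Type) [Field k] [CharP k p]
    {X : Scheme.{0}} [IsIntegral X] (q : X ⟶ Spec (.of k)) [LocallyOfFiniteType q]
    (hreg : Scheme.IsRegular X) (f : Γ(X, ⊤))
    (hsnc : IsStrictNormalCrossingsDivisor X (derivCriticalSet X f)) {ξ₀ : X}
    (hξ₀ : IsClosed ({ξ₀} : Set X)) :
    ∃ (U : X.Opens) (_ : IsAffineOpen U) (_ : ξ₀ ∈ U) (r : ℕ) (x : Fin r → Γ(X, U))
      (δ : Fin r → Derivation ℤ Γ(X, U) Γ(X, U)),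
      (∀ a b, δ a (x b) = if a = b then 1 else 0) ∧
      ∀ (ξ : X) (hξ : ξ ∈ U), ∀ P : Ideal (X.presheaf.stalk ξ),
        P ∈ derivCriticalPrimes (X.presheaf.stalk ξ) (X.presheaf.germ ⊤ ξ trivial f) ↔
          ∃ j, ¬ IsUnit (X.presheaf.germ U ξ hξ (x j)) ∧
            P = Ideal.span {X.presheaf.germ U ξ hξ (x j)} := by
  by_cases hξ₀E : ξ₀ ∈ derivCriticalSet X f
  · exact exists_giraudChart_of_mem p k q hreg f hsnc hξ₀ hξ₀E
  · exact exists_giraudChart_of_not_mem f hsnc.1 hξ₀E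

end Summit.ResolutionOfSingularities.ResolutionOfSingularities.Theorems.RadicialJung.CleanModels
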